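import Literature.AnabelianGeometry.AbsoluteAnabelian.AbsTopIThm26ChiTwistedModelInstances
import Summits.ABC.IUTFork.MLFGaloisTFG
import HarnessLib

/-!
# [AbsTopI] Thm 2.6 (ii) AS TYPED at the χ-twisted model `F̂₂ ⋊_χ G_{ℚ_p} ↠ G_{ℚ_p}` —
# UNCONDITIONAL (abc-iut FACT-LIST row F-0247 `FundamentalExtension.Thm26ii`)

Cell `abc-iut` (run/shared/lean/pub/abc-iut/), block F (fact-proving), tranche 90.  S. Mochizuki,
*Topics in Absolute Anabelian Geometry I* (2012) [AbsTopI], Thm 2.6 (ii) p. 21 (kurims manuscript,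
lit key `paper:url-11ac98ba15fc`); [EtTh] §1 p. 12 (the χ-twisted model of layer L2,
`SettingModel.PiHtχ p = F̂₂ ⋊_{θ∘χ} G_{ℚ_p}`).

The Literature file `AbsTopIThm26ChiTwistedModelInstances.lean` (abc-iut-f-090 gen 2) proves the
typed Thm 2.6 (ii) at the χ-TWISTED model — an extension with NON-TRIVIAL outer Galois action,
`δ¹_l(Π) = δ¹_l(G) + 1` for every prime `l` — GIVEN the one input of the printed proof (p. 23) that is
a theorem of the tree only Summits-side: "the topological finite generation … of `G` [cf. [NSW],
Theorem 7.5.10]" (`isTopologicallyFinitelyGenerated_absoluteGaloisGroup_padic`,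
`Summits/ABC/IUTFork/MLFGaloisTFG.lean`).  A Literature file may not import a Summits file, so the
UNCONDITIONAL forms are assembled here:

* `FundamentalExtension.thm26ii_chiTwistedModel` — the typed (ii) at `F̂₂ ⋊_χ G_{ℚ_p} ↠ G_{ℚ_p}`,
  base datum `(p, ℚ_p, refl)`, `Σ = Primes`: NO hypotheses left;
* `Summit.ABC.IUTFork.exists_thm26ii_thm26iv_twisted` — hence an extension with MLF base data
  satisfying the typed (ii) AND (iv) whose rank difference `δ¹_l(Π) − δ¹_l(G)` is `1` at every `l`
  (neither the point value `0` nor the split-product value `2` for a rank-2 `Δ`): the printed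
  "`dim_{ℚ_l}(Q_l ⊗ ℚ_l)`, independent of `l`" realised by a genuinely Galois-theoretic computation
  (`(Ẑ(χ) ⊗ ℤ_l)_{G_{ℚ_p}}` has no free part, `eq_one_of_chi_invariant`).

HONEST FRAMING: the χ-twisted model is SEMI-SYNTHETIC (not `π₁` of a curve; the abelianised action is
the split Tate-curve shape `Ẑ ⊕ Ẑ(1)`); a satisfiability witness of the typed predicate (whose
universal closure is refuted, `not_forall_thm26ii`).  Nothing here asserts anything about abc or takes
a side on [IUTchIII] Cor. 3.12; typed ≠ proved elsewhere.  Theorems only; axioms standard.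
-/

noncomputable section

namespace Summit.ABC.IUTFork

open Field Literature.AnabelianGeometry.AbsoluteAnabelian Literature.AnabelianGeometry.EtaleTheta
open Literature.AnabelianGeometry.EtaleTheta.SettingModel Literature.AnabelianGeometry.SemiGraphs

/-- **F-0247 `Thm26ii` at the χ-twisted model, UNCONDITIONAL.**  The extension
`1 → F̂₂ → F̂₂ ⋊_χ G_{ℚ_p} → G_{ℚ_p} → 1` ([EtTh] §1 model of layer L2: `G_{ℚ_p}` acts on
`F̂₂ = ⟨a, b⟩^` by `a ↦ a`, `b ↦ b^{χ(σ)}`) with MLF base datum `(p, ℚ_p, refl)` satisfies the typed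
[AbsTopI] Thm 2.6 (ii) for `Σ = Primes`: "`Π` topologically finitely generated" (`F̂₂` by `η a, η b`;
`G_{ℚ_p}` by [NSW] 7.5.10 — `isTopologicallyFinitelyGenerated_absoluteGaloisGroup_padic`); the
`G`-clauses and "`ε¹_p(Π) = ∞`" (local class field theory, tree theorems); "`δ¹_l(Π) − δ¹_l(G)`
independent of `l`": `= 1` (`freeProlRank_piHtχ`).  HONEST LABEL: semi-synthetic model with
non-trivial outer Galois action; not a curve's `π₁`. [cite: MochizukiAbsTopI2012, Thm 2.6 (ii) p.21]
[cite: NeukirchSchmidtWingberg2008, Thm. 7.5.10] -/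
theorem _root_.Literature.AnabelianGeometry.AbsoluteAnabelian.FundamentalExtension.thm26ii_chiTwistedModel
    (p : ℕ) [Fact p.Prime] :
    Literature.AnabelianGeometry.AbsoluteAnabelian.FundamentalExtension.Thm26ii
      ⟨ProfiniteGrp.of (PiHtχ p), absoluteGaloisGrp ℚ_[p], augHatχ p,
        fun σ => ⟨SemidirectProduct.inr σ, rfl⟩⟩
      { p := p, K := ℚ_[p], galIso := ContinuousMulEquiv.refl _ } {q | q.Prime} :=
  FundamentalExtension.thm26ii_chiTwistedModel_of_tfg p
    (isTopologicallyFinitelyGenerated_absoluteGaloisGroup_padic p ℚ_[p])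

/-- **An extension with MLF base data, NON-TRIVIAL outer Galois action, satisfying the typed
[AbsTopI] Thm 2.6 (ii) and (iv) for `Σ = Primes`, with `δ¹_l(Π) = δ¹_l(G) + 1` at every prime `l`**
(unconditional) — the χ-twisted model `F̂₂ ⋊_χ G_{ℚ_p} ↠ G_{ℚ_p}`.  Complements the point instance
(`exists_geom_eq_bot_thm26ii`, rank difference `0`) and the split product (`exists_thm26ii_geom_ne_bot`,
rank difference `n`). [cite: MochizukiAbsTopI2012, Thm 2.6 (ii) p.21] -/
theorem exists_thm26ii_thm26iv_twisted (p : ℕ) [Fact p.Prime] :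
    ∃ (E : FundamentalExtension.{0}) (B : E.MLFBase),
      E.Thm26ii B {q | q.Prime} ∧ E.Thm26iv {q | q.Prime} ∧
        ∀ (l : ℕ) [Fact l.Prime], freeProlRank E.arith l = freeProlRank E.gal l + 1 :=
  FundamentalExtension.exists_thm26ii_thm26iv_rank_add_one p
    (isTopologicallyFinitelyGenerated_absoluteGaloisGroup_padic p ℚ_[p])

end Summit.ABC.IUTFork

end
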